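import Summits.QuantumFields.BalabanUV.T4Continuum.Support.NE3MajorantProfile
import HarnessLib

/-!
# T⁴ programme, node NE3, route Π (Γ″) · γ4″ (file B2) — THE MAJORANT TOWERS EVALUATED k-FREE ON CONSTANTS AND ON COULOMB PROFILES
# (the Grönwall step of the Duhamel expansion)

NE3 formalisation swarm `b2b-balaban-t4-ne3-formalise-*`, LEAF PROVER 04 (gen 8), written for the Π-C-3γ holder `leaf-02-g8`
(γ4″; journal HOME/CLAIMS.log l.25119 «NOT MINE — GO», l.25129, l.25283).  Sequel of `NE3MajorantProfile` (tiling + profile lemma).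

CONTENT (all [folklore]; 0 sorry; real DATA defs `cK`, `Kprod`, `Lprod` → async audit):
* §1 closures at one level: `segStep` of a constant is `L·s` exactly; `locStep ≤ Csup·(local sup)` (the `hloc` of this lineage's
  `norm_Dstr_le_sup`, on weights); `treeStep ≤ dL·(local sup)`; the profile on the `nbRad`-ball about `L•z` against the coarse profile
  at the block index: `prof p c y ≤ (1 + nbRad + dL)^p · prof p (blockIdx L c) z`; block indices compose (`blockIdx_blockIdx`).
* §2 the σ-tier: `majIter d L j x (const s) ≤ Lprod d L j x · s`, `Lprod = Π_i (L + wC xᵢ) ≤ 2·L^j` when `Ssum ≤ 1 ≤ L∕2` (class + `L ≥ 2`);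
  the products lemma `Π (1 + aᵢ) ≤ 1∕(1 − Σ aᵢ)`.
* §3 THE GRÖNWALL STEP: **`majIter_iterate_profW_le`** —
  `majIter d L j x ((segStep L)^[r] (profW p c)) z κ ≤ cP d p · Kprod d L p j x · (L^{r+j} ∕ (L^{r+j})^p) · prof p (blockIdx (L^{r+j}) c) z`
  for `p + 1 ≤ d`, EVERY `j r x c z κ` (`x ≥ 0`): induction on `j` over file A's Duhamel step, the straight part carried as an exact
  iterate and read by the profile lemma at its birth level, the defect part re-centred on the block index and fed back at `r = 0`;
  `Kprod (j+1) x = Kprod j x₁ · (1 + cK·wC d L x)`, `cK d L p = cP d p · (1 + nbRad + dL)^p · L^{p−1}`; `Kprod ≤ 2` when `cK·Ssum ≤ 1∕2`.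
* §4 the frame tower: `frameMaj d L (j+1) x ω z = Σ_{i≤j} treeStep L (majIter d L i x ω) (L^{j−i}•z)` (unrolled), hence
  `frameMaj … (const s) z ≤ 2dL·L^{j+1}·s` and `frameMaj … (profW p c) z ≤ 2dL·cP·Kprod·2` for `2 ≤ p` (`Σ_i (L^i)^{1−p} ≤ 2`).

HONEST: real analysis + positivity bookkeeping on OUR frame; nothing about minimisers, (Π-REG-γ″), Π-C-3γ″, T-E_w♯ or NE3 is asserted;
NE3 NOT proved; spine PROVED 0∕9; finite T⁴ rung (B)+1 — NOT infinite volume, NOT mass gap, NOT BetaPertH, NOT Clay.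
PLACEMENT: `Summits/QuantumFields/BalabanUV/` (cell rule).
-/

set_option autoImplicit false

open scoped BigOperators Matrix.Norms.L2Operator
open Finset

namespace Summit.QuantumFields.BalabanUV.T4Continuum.NE3MajorantProfileTower

open Literature.MathematicalPhysics.QuantumFieldTheory.Balaban1983to89
open B7Prop1Explicit B7Prop2Explicit
open AveragingDeficitCounting (mem_box_iff blockIdx mem_box_blockBase)
open AveragingDeficitSideDeriv (loopWord)
open AveragingDeficitTwoLevelPrep (prop1Radius)
open AveragingDeficitMultiLevelPrep (LevelSmall prop1Radius_nonneg)
open BlockAverageVaryHolo (nbRad length_loopWord_le)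
open BlockAveragePushDirSplit (sum_blockWeight_eq_one)
open BlockAverageDbarLinNorms (l1_natCast_smul_e)
open NE3CombVsTowerStraighten (l1_natCast_smul)
open NE3CovariantLineSumsError (Csup wC Ssum Ssum_succ Csup_nonneg wC_nonneg Ssum_nonneg Ssum_le_one)
open NE3QbarIterMajorant (lsum lsum_mono lsum_nonneg lsum_le_length_mul_sup segW locW wlin segStep locStep stepMaj majIter majIter_zero
  majIter_succ majIter_mono majIter_smul majIter_nonneg majIter_succ_eq_duhamel stepMaj_apply segW_mono locW_mono locW_smul locW_nonneg)
open NE3DirIterMajorant (treeW₀ treeStep frameMaj frameMaj_zero frameMaj_succ treeW₀_mono)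
open NE3MajorantProfile (lsum_seg_eq_sum segStepM segStep_eq_segStepM iterate_segStep prof profW prof_nonneg prof_le_one prof_le_of_le
  cP cP_nonneg segStepM_profW_le l1_sub_blockIdx_le)

noncomputable section

variable {d : ℕ}

/-! ## §1 One-level closures -/

/-- `lsum` of a constant weight along a word is `|Γ|·s`. [folklore] -/
theorem lsum_const (s : ℝ) : ∀ (x : Site d) (w : List (Letter d)), lsum (fun (_ : Site d) (_ : Fin d) => s) x w = w.length * s
  | x, [] => by simp
  | x, l :: w => by rw [NE3QbarIterMajorant.lsum_cons, lsum_const s (x + l.vec) w, List.length_cons]; push_cast; ring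

/-- THE STRAIGHT STEP OF A CONSTANT IS EXACT: `segStep L (const s) z κ = L·s` (`L ≥ 1`). [folklore] -/
theorem segStep_const {L : ℕ} (hL : 1 ≤ L) (s : ℝ) (z : Site d) (κ : Fin d) : segStep L (fun (_ : Site d) (_ : Fin d) => s) z κ = L * s := by
  simp only [segStep, segW, lsum_const, length_seg, Int.natAbs_natCast]
  rw [← Finset.sum_mul, sum_blockWeight_eq_one L hL, one_mul]

/-- THE LOCAL DEFECT STEP AGAINST A LOCAL SUP: if `ω(b) ≤ s` (`s ≥ 0`) on the bonds starting within ℓ¹-distance `nbRad d L` of `L•z`, then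
`locStep L ω z κ ≤ Csup d L · s` (the loop ∕ tree ∕ segment words of the one-level defect have `≤ nbRad`, `≤ dL`, `= L` letters). [folklore] -/
theorem locStep_le_of_sup {L : ℕ} (hL : 1 ≤ L) {ω : Site d → Fin d → ℝ} {z : Site d} {s : ℝ} (hs : 0 ≤ s)
    (hω : ∀ (y : Site d) (μ : Fin d), l1 (y - (L : ℤ) • z) ≤ nbRad d L → ω y μ ≤ s) (κ : Fin d) : locStep L ω z κ ≤ Csup d L * s := by
  set q : Site d := (L : ℤ) • z with hq
  have hwt := sum_blockWeight_eq_one (d := d) L hL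
  have hseg0 : lsum ω q (seg κ L) ≤ L * s := by
    have h := lsum_le_length_mul_sup ω hω (seg κ (L : ℤ)) q (by rw [hq, sub_self, length_seg, Int.natAbs_natCast, nbRad]; simp [l1]; omega)
    rwa [length_seg, Int.natAbs_natCast] at h
  have hloop : ∑ r : Fin d → Fin L, ((L : ℝ) ^ d)⁻¹ * lsum ω q (loopWord L κ (boxVec L r)) ≤ (nbRad d L : ℝ) * s := by
    calc _ ≤ ∑ _r : Fin d → Fin L, ((L : ℝ) ^ d)⁻¹ * ((nbRad d L : ℝ) * s) := by
          refine Finset.sum_le_sum fun r _ => mul_le_mul_of_nonneg_left ?_ (by positivity)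
          have h := lsum_le_length_mul_sup ω hω (loopWord L κ (boxVec L r)) q (by
            rw [hq, sub_self]; simp only [l1, Pi.zero_apply, Int.natAbs_zero, Finset.sum_const_zero, zero_add]
            exact length_loopWord_le L κ r)
          exact h.trans (mul_le_mul_of_nonneg_right (by exact_mod_cast length_loopWord_le L κ r) hs)
      _ = (nbRad d L : ℝ) * s := by rw [← Finset.sum_mul, hwt, one_mul]
  have htree : ∑ r : Fin d → Fin L, ((L : ℝ) ^ d)⁻¹ * lsum ω (q + (L : ℤ) • e κ) (treeWord (boxVec L r)) ≤ (d * L : ℝ) * s := by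
    calc _ ≤ ∑ _r : Fin d → Fin L, ((L : ℝ) ^ d)⁻¹ * ((d * L : ℝ) * s) := by
          refine Finset.sum_le_sum fun r _ => mul_le_mul_of_nonneg_left ?_ (by positivity)
          have hlen : (treeWord (boxVec L r)).length ≤ d * L := by rw [length_treeWord]; exact l1_boxVec_le L r
          have h := lsum_le_length_mul_sup ω hω (treeWord (boxVec L r)) (q + (L : ℤ) • e κ) (by
            rw [hq, add_sub_cancel_left, l1_natCast_smul_e, length_treeWord, nbRad]; have := l1_boxVec_le L r; omega)
          exact h.trans (mul_le_mul_of_nonneg_right (by exact_mod_cast hlen) hs)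
      _ = (d * L : ℝ) * s := by rw [← Finset.sum_mul, hwt, one_mul]
  show locW L ω q κ ≤ _
  unfold locW NE3QbarIterMajorant.loopW NE3QbarIterMajorant.treeW'
  unfold Csup
  nlinarith [hseg0, hloop, htree, hs]

/-- THE TREE FUNCTIONAL AGAINST A LOCAL SUP: `ω(b) ≤ s` on the bonds starting within `nbRad d L` of `L•y` ⟹ `treeStep L ω y ≤ dL·s`. [folklore] -/
theorem treeStep_le_of_sup {L : ℕ} (hL : 1 ≤ L) {ω : Site d → Fin d → ℝ} {y : Site d} {s : ℝ} (hs : 0 ≤ s)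
    (hω : ∀ (y' : Site d) (μ : Fin d), l1 (y' - (L : ℤ) • y) ≤ nbRad d L → ω y' μ ≤ s) : treeStep L ω y ≤ (d * L : ℝ) * s := by
  have hwt := sum_blockWeight_eq_one (d := d) L hL
  show treeW₀ L ω ((L : ℤ) • y) ≤ _
  unfold treeW₀
  calc _ ≤ ∑ _r : Fin d → Fin L, ((L : ℝ) ^ d)⁻¹ * ((d * L : ℝ) * s) := by
        refine Finset.sum_le_sum fun r _ => mul_le_mul_of_nonneg_left ?_ (by positivity)
        have hlen : (treeWord (boxVec L r)).length ≤ d * L := by rw [length_treeWord]; exact l1_boxVec_le L r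
        have h := lsum_le_length_mul_sup ω hω (treeWord (boxVec L r)) ((L : ℤ) • y) (by
          rw [sub_self, length_treeWord, nbRad]; have := l1_boxVec_le L r
          have h0 : l1 (0 : Site d) = 0 := by simp [l1]
          rw [h0]; omega)
        exact h.trans (mul_le_mul_of_nonneg_right (by exact_mod_cast hlen) hs)
    _ = (d * L : ℝ) * s := by rw [← Finset.sum_mul, hwt, one_mul]

/-- Comparison of profiles at two points∕centres: if `|z − c₁|₁ ≤ |y − c|₁ + R′` with `1 ≤ R′`, then
`prof p c y ≤ (1 + R′)^p · prof p c₁ z`. [folklore] -/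
theorem prof_le_of_dist {p : ℕ} {c y c₁ z : Site d} {R' : ℝ} (hR : 1 ≤ R') (h : (l1 (z - c₁) : ℝ) ≤ l1 (y - c) + R') :
    prof p c y ≤ (1 + R') ^ p * prof p c₁ z := by
  have hD0 : (0 : ℝ) ≤ l1 (z - c₁) := Nat.cast_nonneg _
  have hl0 : (0 : ℝ) ≤ l1 (y - c) := Nat.cast_nonneg _
  have key : 1 + (l1 (z - c₁) : ℝ) / 2 ≤ (1 + R') * (1 + (l1 (y - c) : ℝ) / 2) := by
    by_cases hc : (l1 (z - c₁) : ℝ) ≤ 2 * R'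
    · nlinarith
    · rw [not_le] at hc
      nlinarith
  have h := prof_le_of_le (p := p) (c := c) (y := y) (A := 1 + R') (D := (l1 (z - c₁) : ℝ)) (by positivity) key
  simpa [prof] using h

/-- THE PROFILE ON THE ONE-STEP BALL AGAINST THE COARSE PROFILE AT THE BLOCK INDEX: for `l1 (y − L•z) ≤ nbRad d L` (`L ≥ 1`),
`prof p c y ≤ (1 + nbRad + dL)^p · prof p (blockIdx L c) z`. [folklore] -/
theorem prof_ball_le {L : ℕ} (hL : 1 ≤ L) (p : ℕ) (c : Site d) {y z : Site d} (hy : l1 (y - (L : ℤ) • z) ≤ nbRad d L) :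
    prof p c y ≤ (1 + ((nbRad d L : ℝ) + d * L)) ^ p * prof p (blockIdx L c) z := by
  apply prof_le_of_dist
  · have hL1 : (1 : ℝ) ≤ L := by exact_mod_cast hL
    have hd1 : (0 : ℝ) ≤ d := Nat.cast_nonneg _
    unfold nbRad; push_cast; nlinarith
  · -- `L·|z − c₁|₁ = |L•z − L•c₁|₁ ≤ |L•z − y|₁ + |y − c|₁ + |c − L•c₁|₁`
    set c₁ := blockIdx L c
    have hLz : l1 ((L : ℤ) • z - ((L : ℕ) : ℤ) • c₁) = L * l1 (z - c₁) := by rw [show ((L : ℕ) : ℤ) = (L : ℤ) by rfl, ← smul_sub, l1_natCast_smul]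
    have hsplit : (L : ℤ) • z - ((L : ℕ) : ℤ) • c₁ = -(y - (L : ℤ) • z) + (y - c) + (c - ((L : ℕ) : ℤ) • c₁) := by abel
    have htri : l1 ((L : ℤ) • z - ((L : ℕ) : ℤ) • c₁) ≤ l1 (y - (L : ℤ) • z) + l1 (y - c) + l1 (c - ((L : ℕ) : ℤ) • c₁) := by
      rw [hsplit]
      refine (l1_add_le _ _).trans (add_le_add ((l1_add_le _ _).trans (add_le_add (by rw [l1_neg]) le_rfl)) le_rfl)
    have hcc := l1_sub_blockIdx_le (d := d) hL c
    have hL1 : (1 : ℝ) ≤ L := by exact_mod_cast hL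
    have hD0 : (0 : ℝ) ≤ l1 (z - c₁) := Nat.cast_nonneg _
    have htri' : ((L : ℝ) * l1 (z - c₁)) ≤ (nbRad d L : ℝ) + l1 (y - c) + l1 (c - ((L : ℕ) : ℤ) • c₁) := by
      have : ((l1 ((L : ℤ) • z - ((L : ℕ) : ℤ) • c₁) : ℕ) : ℝ) ≤ ((l1 (y - (L : ℤ) • z) + l1 (y - c) + l1 (c - ((L : ℕ) : ℤ) • c₁) : ℕ) : ℝ) := by
        exact_mod_cast htri
      rw [hLz] at this; push_cast at this
      have hy' : (l1 (y - (L : ℤ) • z) : ℝ) ≤ nbRad d L := by exact_mod_cast hy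
      linarith
    nlinarith

/-- Block indices compose: `blockIdx M₂ (blockIdx M₁ c) = blockIdx (M₁·M₂) c` (`M₁ ≥ 1`; integer division by positives). [folklore] -/
theorem blockIdx_blockIdx (M₁ M₂ : ℕ) (c : Site d) : blockIdx M₂ (blockIdx M₁ c) = blockIdx (M₁ * M₂) c := by
  funext i
  simp only [blockIdx]
  push_cast
  exact Int.ediv_ediv_of_nonneg (by positivity)

/-- `blockIdx 1 c = c`. [folklore] -/
theorem blockIdx_one (c : Site d) : blockIdx 1 c = c := by
  funext i; simp [blockIdx]

/-! ## §2 The σ-tier -/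

/-- THE σ-TIER PRODUCT `Lprod d L j x = Π_{i<j} (L + wC d L xᵢ)` (inner-first). [folklore] -/
def Lprod (d L : ℕ) : ℕ → ℝ → ℝ
  | 0, _ => 1
  | j + 1, x => Lprod d L j (prop1Radius d L x) * ((L : ℝ) + wC d L x)

/-- `0 ≤ Lprod` for `x ≥ 0`. [folklore] -/
theorem Lprod_nonneg (d L : ℕ) : ∀ (j : ℕ) {x : ℝ}, 0 ≤ x → 0 ≤ Lprod d L j x
  | 0, _, _ => zero_le_one
  | j + 1, _, hx => mul_nonneg (Lprod_nonneg d L j (prop1Radius_nonneg hx)) (add_nonneg (Nat.cast_nonneg _) (wC_nonneg d L hx))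

/-- **THE σ-TIER**: `majIter d L j x (const s) z κ ≤ Lprod d L j x · s` for `s ≥ 0`, `x ≥ 0`, `L ≥ 1` (the straight step of a constant is
`L·s` exactly, the defect step at most `Csup·s`, and `wlin·Csup = wC`). [folklore] -/
theorem majIter_const_le {L : ℕ} (hL : 1 ≤ L) : ∀ (j : ℕ) {x : ℝ}, 0 ≤ x → ∀ {s : ℝ}, 0 ≤ s → ∀ (z : Site d) (κ : Fin d),
    majIter d L j x (fun (_ : Site d) (_ : Fin d) => s) z κ ≤ Lprod d L j x * s
  | 0, _, _, _, _, z, κ => by simp [Lprod]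
  | j + 1, x, hx, s, hs, z, κ => by
      rw [majIter_succ]
      have hstep : ∀ (y : Site d) (μ : Fin d), stepMaj d L x (fun (_ : Site d) (_ : Fin d) => s) y μ ≤ ((L : ℝ) + wC d L x) * s := by
        intro y μ
        have hseg : segStep L (fun (_ : Site d) (_ : Fin d) => s) y μ = L * s := segStep_const hL s y μ
        have hloc : locStep L (fun (_ : Site d) (_ : Fin d) => s) y μ ≤ Csup d L * s := locStep_le_of_sup hL hs (fun _ _ _ => le_rfl) μ
        have hw := NE3QbarIterMajorant.wlin_nonneg d L hx
        have e : wC d L x = wlin d L x * Csup d L := rfl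
        have h1 : stepMaj d L x (fun (_ : Site d) (_ : Fin d) => s) y μ
            = segStep L (fun (_ : Site d) (_ : Fin d) => s) y μ + wlin d L x * locStep L (fun (_ : Site d) (_ : Fin d) => s) y μ := rfl
        rw [h1, hseg, e]
        nlinarith [mul_le_mul_of_nonneg_left hloc hw]
      have hx₁ := prop1Radius_nonneg (d := d) (L := L) hx
      have hc : 0 ≤ ((L : ℝ) + wC d L x) * s := mul_nonneg (add_nonneg (Nat.cast_nonneg _) (wC_nonneg d L hx)) hs
      calc majIter d L j (prop1Radius d L x) (stepMaj d L x fun _ _ => s) z κ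
          ≤ majIter d L j (prop1Radius d L x) (fun (_ : Site d) (_ : Fin d) => ((L : ℝ) + wC d L x) * s) z κ := majIter_mono d L j hx₁ hstep z κ
        _ ≤ Lprod d L j (prop1Radius d L x) * (((L : ℝ) + wC d L x) * s) := majIter_const_le hL j hx₁ hc z κ
        _ = Lprod d L (j + 1) x * s := by simp only [Lprod]; ring

/-- The product against the level sum: `Lprod d L j x · (1 − Ssum d L j x ∕ L) ≤ L^j` (`x ≥ 0`, `L ≥ 1`). [folklore] -/
theorem Lprod_mul_le {L : ℕ} (hL : 1 ≤ L) : ∀ (j : ℕ) {x : ℝ}, 0 ≤ x → Lprod d L j x * (1 - Ssum d L j x / L) ≤ (L : ℝ) ^ j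
  | 0, _, _ => by simp [Lprod, Ssum]
  | j + 1, x, hx => by
      have hL0 : (0 : ℝ) < L := by exact_mod_cast (by omega : 0 < L)
      have hx₁ := prop1Radius_nonneg (d := d) (L := L) hx
      have ih := Lprod_mul_le hL j hx₁
      have hP := Lprod_nonneg d L j hx₁
      have hw := wC_nonneg d L hx
      have hS := Ssum_nonneg d L j hx₁
      simp only [Lprod, Ssum_succ]
      -- `(L + w)(1 − (w + S′)/L) ≤ L(1 − S′/L)`
      have halg : ((L : ℝ) + wC d L x) * (1 - (wC d L x + Ssum d L j (prop1Radius d L x)) / L)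
          ≤ L * (1 - Ssum d L j (prop1Radius d L x) / L) := by
        have e : ((L : ℝ) + wC d L x) * (1 - (wC d L x + Ssum d L j (prop1Radius d L x)) / L)
            = L * (1 - Ssum d L j (prop1Radius d L x) / L) - (wC d L x ^ 2 + wC d L x * Ssum d L j (prop1Radius d L x)) / L := by
          field_simp; ring
        rw [e]
        have : 0 ≤ (wC d L x ^ 2 + wC d L x * Ssum d L j (prop1Radius d L x)) / L := by positivity
        linarith
      calc Lprod d L j (prop1Radius d L x) * ((L : ℝ) + wC d L x) * (1 - (wC d L x + Ssum d L j (prop1Radius d L x)) / L)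
          = Lprod d L j (prop1Radius d L x) * (((L : ℝ) + wC d L x) * (1 - (wC d L x + Ssum d L j (prop1Radius d L x)) / L)) := by ring
        _ ≤ Lprod d L j (prop1Radius d L x) * (L * (1 - Ssum d L j (prop1Radius d L x) / L)) := mul_le_mul_of_nonneg_left halg hP
        _ = L * (Lprod d L j (prop1Radius d L x) * (1 - Ssum d L j (prop1Radius d L x) / L)) := by ring
        _ ≤ L * (L : ℝ) ^ j := mul_le_mul_of_nonneg_left ih hL0.le
        _ = (L : ℝ) ^ (j + 1) := by ring

/-- **`Lprod ≤ 2·L^j` IN THE CLASS**: `L ≥ 2`, `x ≥ 0`, `Ssum d L j x ≤ 1` (`NE3CovariantLineSumsError.Ssum_le_one`). [folklore] -/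
theorem Lprod_le {L : ℕ} (hL : 2 ≤ L) (j : ℕ) {x : ℝ} (hx : 0 ≤ x) (hS : Ssum d L j x ≤ 1) : Lprod d L j x ≤ 2 * (L : ℝ) ^ j := by
  have hL2 : (2 : ℝ) ≤ L := by exact_mod_cast hL
  have hL0 : (0 : ℝ) < L := by linarith
  have h := Lprod_mul_le (d := d) (by omega : 1 ≤ L) j hx
  have hfac : (1 : ℝ) / 2 ≤ 1 - Ssum d L j x / L := by
    have : Ssum d L j x / L ≤ 1 / 2 := by rw [div_le_iff₀ hL0]; linarith
    linarith
  have hP := Lprod_nonneg d L j hx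
  nlinarith [mul_le_mul_of_nonneg_left hfac hP]

/-! ## §3 The Grönwall step for Coulomb profiles -/

/-- THE DEFECT-INSERTION CONSTANT `cK d L p = cP d p · (1 + nbRad + dL)^p · L^{p−1}`. [folklore] -/
def cK (d L p : ℕ) : ℝ := cP d p * (1 + ((nbRad d L : ℝ) + d * L)) ^ p * (L : ℝ) ^ (p - 1)

/-- `0 ≤ cK`. [folklore] -/
theorem cK_nonneg (d L p : ℕ) : 0 ≤ cK d L p := by unfold cK; have := cP_nonneg d p; positivity

/-- THE GRÖNWALL PRODUCT `Kprod d L p j x = Π_{i<j} (1 + cK·wC d L xᵢ)` (inner-first). [folklore] -/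
def Kprod (d L p : ℕ) : ℕ → ℝ → ℝ
  | 0, _ => 1
  | j + 1, x => Kprod d L p j (prop1Radius d L x) * (1 + cK d L p * wC d L x)

/-- `1 ≤ Kprod` for `x ≥ 0`. [folklore] -/
theorem one_le_Kprod (d L p : ℕ) : ∀ (j : ℕ) {x : ℝ}, 0 ≤ x → 1 ≤ Kprod d L p j x
  | 0, _, _ => le_rfl
  | j + 1, _, hx => by
      simp only [Kprod]
      have h1 := one_le_Kprod d L p j (prop1Radius_nonneg (d := d) (L := L) hx)
      have h2 : (1 : ℝ) ≤ 1 + cK d L p * wC d L _ := le_add_of_nonneg_right (mul_nonneg (cK_nonneg d L p) (wC_nonneg d L hx))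
      nlinarith

/-- `Kprod j (x₁) ≤ Kprod (j+1) x` — more levels, larger product. [folklore] -/
theorem Kprod_le_succ (d L p : ℕ) (j : ℕ) {x : ℝ} (hx : 0 ≤ x) : Kprod d L p j (prop1Radius d L x) ≤ Kprod d L p (j + 1) x := by
  simp only [Kprod]
  have h1 := one_le_Kprod d L p j (prop1Radius_nonneg (d := d) (L := L) hx)
  have h2 : (1 : ℝ) ≤ 1 + cK d L p * wC d L x := le_add_of_nonneg_right (mul_nonneg (cK_nonneg d L p) (wC_nonneg d L hx))
  nlinarith

/-- The product against the level sum: `Kprod d L p j x · (1 − cK·Ssum d L j x) ≤ 1` (`x ≥ 0`). [folklore] -/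
theorem Kprod_mul_le (d L p : ℕ) : ∀ (j : ℕ) {x : ℝ}, 0 ≤ x → Kprod d L p j x * (1 - cK d L p * Ssum d L j x) ≤ 1
  | 0, _, _ => by simp [Kprod, Ssum]
  | j + 1, x, hx => by
      have hx₁ := prop1Radius_nonneg (d := d) (L := L) hx
      have ih := Kprod_mul_le d L p j hx₁
      have hP : 0 ≤ Kprod d L p j (prop1Radius d L x) := le_trans zero_le_one (one_le_Kprod d L p j hx₁)
      have ha : 0 ≤ cK d L p * wC d L x := mul_nonneg (cK_nonneg d L p) (wC_nonneg d L hx)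
      have hS : 0 ≤ cK d L p * Ssum d L j (prop1Radius d L x) := mul_nonneg (cK_nonneg d L p) (Ssum_nonneg d L j hx₁)
      simp only [Kprod, Ssum_succ]
      have halg : (1 + cK d L p * wC d L x) * (1 - cK d L p * (wC d L x + Ssum d L j (prop1Radius d L x)))
          ≤ 1 - cK d L p * Ssum d L j (prop1Radius d L x) := by nlinarith
      calc Kprod d L p j (prop1Radius d L x) * (1 + cK d L p * wC d L x) * (1 - cK d L p * (wC d L x + Ssum d L j (prop1Radius d L x)))
          = Kprod d L p j (prop1Radius d L x) * ((1 + cK d L p * wC d L x) * (1 - cK d L p * (wC d L x + Ssum d L j (prop1Radius d L x)))) := by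
            ring
        _ ≤ Kprod d L p j (prop1Radius d L x) * (1 - cK d L p * Ssum d L j (prop1Radius d L x)) := mul_le_mul_of_nonneg_left halg hP
        _ ≤ 1 := ih

/-- **`Kprod ≤ 2` UNDER THE k-FREE SMALLNESS LINE `cK·Ssum ≤ 1∕2`**. [folklore] -/
theorem Kprod_le_two (d L p : ℕ) (j : ℕ) {x : ℝ} (hx : 0 ≤ x) (hK : cK d L p * Ssum d L j x ≤ 1 / 2) : Kprod d L p j x ≤ 2 := by
  have h := Kprod_mul_le d L p j hx
  have hP : 0 ≤ Kprod d L p j x := le_trans zero_le_one (one_le_Kprod d L p j hx)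
  nlinarith

/-- The dilution factor `ρ m = L^m ∕ (L^m)^p`. [folklore] -/
theorem rho_mul (L : ℕ) (hL : 1 ≤ L) (p r j : ℕ) (hp : 1 ≤ p) :
    ((L : ℝ) ^ r / ((L : ℝ) ^ r) ^ p) * ((L : ℝ) ^ j / ((L : ℝ) ^ j) ^ p)
      = ((L : ℝ) ^ (r + j + 1) / ((L : ℝ) ^ (r + j + 1)) ^ p) * (L : ℝ) ^ (p - 1) := by
  have hL0 : (L : ℝ) ≠ 0 := by exact_mod_cast (by omega : L ≠ 0)
  obtain ⟨q, rfl⟩ : ∃ q, p = q + 1 := ⟨p - 1, by omega⟩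
  simp only [Nat.add_sub_cancel]
  field_simp
  ring

/-- **THE GRÖNWALL STEP — THE MAJORANT TOWER ON AN ITERATED COULOMB PROFILE**: for `p + 1 ≤ d`, `1 ≤ p`, `L ≥ 1` and EVERY `j, r, x ≥ 0, c`,
`majIter d L j x ((segStep L)^[r] (profW p c)) z κ ≤ cP d p · Kprod d L p j x · (L^{r+j} ∕ (L^{r+j})^p) · prof p (blockIdx (L^{r+j}) c) z`.
Induction on `j` through file A's Duhamel step: the straight part stays an exact iterate (read by the profile lemma only at `j = 0`), the
defect part is re-centred on the block index by `prof_ball_le`, bounded by `locStep_le_of_sup`, and fed back at `r = 0`. [folklore] -/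
theorem majIter_iterate_profW_le (hd : 1 ≤ d) {p : ℕ} (hp1 : 1 ≤ p) (hp : p + 1 ≤ d) {L : ℕ} (hL : 1 ≤ L) :
    ∀ (j r : ℕ) {x : ℝ}, 0 ≤ x → ∀ (c z : Site d) (κ : Fin d),
    majIter d L j x ((segStep L)^[r] (profW p c)) z κ
      ≤ cP d p * Kprod d L p j x * ((L : ℝ) ^ (r + j) / ((L : ℝ) ^ (r + j)) ^ p) * prof p (blockIdx (L ^ (r + j)) c) z
  | 0, r, x, hx, c, z, κ => by
      rw [majIter_zero, iterate_segStep hL, add_zero]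
      simp only [Kprod, mul_one]
      have h := segStepM_profW_le hd hp (M := L ^ r) (Nat.one_le_pow r L hL) c z κ
      push_cast at h ⊢
      exact h
  | j + 1, r, x, hx, c, z, κ => by
      have hx₁ := prop1Radius_nonneg (d := d) (L := L) hx
      have hL0 : (0 : ℝ) < L := by exact_mod_cast (by omega : 0 < L)
      rw [majIter_succ_eq_duhamel]
      simp only
      -- first term: the straight part, one more iterate
      have h1 := majIter_iterate_profW_le hd hp1 hp hL j (r + 1) hx₁ c z κ
      rw [Function.iterate_succ_apply'] at h1
      rw [show r + 1 + j = r + (j + 1) by omega] at h1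
      -- second term: the defect part, read at its birth level
      set θr := (segStep L)^[r] (profW (d := d) p c) with hθr
      set cr : Site d := blockIdx (L ^ r) c with hcr
      set ρr : ℝ := (L : ℝ) ^ r / ((L : ℝ) ^ r) ^ p with hρr
      have hρr0 : 0 ≤ ρr := by rw [hρr]; positivity
      -- (i) the iterate is a diluted profile at its own level
      have hθ : ∀ (y : Site d) (μ : Fin d), θr y μ ≤ cP d p * ρr * prof p cr y := by
        intro y μ
        have h := segStepM_profW_le hd hp (Nat.one_le_pow r L hL) c y μ
        rw [hθr, iterate_segStep hL]
        push_cast at h ⊢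
        exact h
      -- (ii) its defect step is a profile at the next level, centred at the next block index
      set R' : ℝ := 1 + ((nbRad d L : ℝ) + d * L) with hR'
      have hloc : ∀ (y : Site d) (μ : Fin d), locStep L θr y μ ≤ (cP d p * ρr * (Csup d L * R' ^ p)) * prof p (blockIdx L cr) y := by
        intro y μ
        have hm : locStep L θr y μ ≤ locStep L (fun y' μ' => (cP d p * ρr) * profW p cr y' μ') y μ :=
          locW_mono L (fun y' μ' => by simpa [profW] using hθ y' μ') _ _
        have hsm : locStep L (fun y' μ' => (cP d p * ρr) * profW p cr y' μ') y μ = (cP d p * ρr) * locStep L (profW p cr) y μ :=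
          locW_smul L _ _ _ _
        have hball : locStep L (profW p cr) y μ ≤ Csup d L * (R' ^ p * prof p (blockIdx L cr) y) :=
          locStep_le_of_sup hL (mul_nonneg (pow_nonneg (by rw [hR']; positivity) _) (prof_nonneg _ _ _))
            (fun y' μ' hy' => by simpa [profW] using prof_ball_le hL p cr hy') μ
        calc locStep L θr y μ ≤ (cP d p * ρr) * locStep L (profW p cr) y μ := by rw [← hsm]; exact hm
          _ ≤ (cP d p * ρr) * (Csup d L * (R' ^ p * prof p (blockIdx L cr) y)) :=
              mul_le_mul_of_nonneg_left hball (mul_nonneg (cP_nonneg d p) hρr0)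
          _ = _ := by ring
      -- (iii) feed the re-centred profile back through `j` levels at `r = 0`
      have h2 := majIter_iterate_profW_le hd hp1 hp hL j 0 hx₁ (blockIdx L cr) z κ
      rw [Function.iterate_zero, id_eq, zero_add] at h2
      have hcomp : blockIdx (L ^ j) (blockIdx L cr) = blockIdx (L ^ (r + (j + 1))) c := by
        rw [hcr, blockIdx_blockIdx, blockIdx_blockIdx]; congr 1; ring
      rw [hcomp] at h2
      have hC0 : 0 ≤ cP d p * ρr * (Csup d L * R' ^ p) := by have := cP_nonneg d p; have := Csup_nonneg d L; positivity
      have h2' : majIter d L j (prop1Radius d L x) (locStep L θr) z κ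
          ≤ (cP d p * ρr * (Csup d L * R' ^ p)) * (cP d p * Kprod d L p j (prop1Radius d L x) * ((L : ℝ) ^ j / ((L : ℝ) ^ j) ^ p)
              * prof p (blockIdx (L ^ (r + (j + 1))) c) z) := by
        calc _ ≤ majIter d L j (prop1Radius d L x) (fun y μ => (cP d p * ρr * (Csup d L * R' ^ p)) * profW p (blockIdx L cr) y μ) z κ :=
              majIter_mono d L j hx₁ (fun y μ => by simpa [profW] using hloc y μ) z κ
          _ = (cP d p * ρr * (Csup d L * R' ^ p)) * majIter d L j (prop1Radius d L x) (profW p (blockIdx L cr)) z κ := by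
              rw [majIter_smul]
          _ ≤ _ := mul_le_mul_of_nonneg_left h2 hC0
      -- assemble with `wlin·Csup = wC`, `ρ_r·ρ_j = ρ_{r+j+1}·L^{p−1}`, `Kprod (j+1) x = Kprod j x₁ (1 + cK wC x)`
      have hρ := rho_mul L hL p r j hp1
      have hw : 0 ≤ wlin d L x := NE3QbarIterMajorant.wlin_nonneg d L hx
      have hpf := prof_nonneg p (blockIdx (L ^ (r + (j + 1))) c) z
      have hK1 := one_le_Kprod d L p j hx₁
      have hcP := cP_nonneg d p
      have e1 : wC d L x = wlin d L x * Csup d L := rfl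
      have eK : Kprod d L p (j + 1) x = Kprod d L p j (prop1Radius d L x) * (1 + cK d L p * wC d L x) := rfl
      have ecK : cK d L p = cP d p * R' ^ p * (L : ℝ) ^ (p - 1) := rfl
      set P := prof p (blockIdx (L ^ (r + (j + 1))) c) z
      set ρ := (L : ℝ) ^ (r + (j + 1)) / ((L : ℝ) ^ (r + (j + 1))) ^ p
      have hρeq : ρr * ((L : ℝ) ^ j / ((L : ℝ) ^ j) ^ p) = ρ * (L : ℝ) ^ (p - 1) := by
        rw [hρr, hρ]; congr 2
      calc majIter d L j (prop1Radius d L x) (segStep L θr) z κ + wlin d L x * majIter d L j (prop1Radius d L x) (locStep L θr) z κ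
          ≤ cP d p * Kprod d L p j (prop1Radius d L x) * ρ * P
            + wlin d L x * ((cP d p * ρr * (Csup d L * R' ^ p)) * (cP d p * Kprod d L p j (prop1Radius d L x)
                * ((L : ℝ) ^ j / ((L : ℝ) ^ j) ^ p) * P)) := add_le_add h1 (mul_le_mul_of_nonneg_left h2' hw)
        _ = cP d p * Kprod d L p j (prop1Radius d L x) * ρ * P
            * (1 + (wlin d L x * Csup d L) * (cP d p * R' ^ p) * ((ρr * ((L : ℝ) ^ j / ((L : ℝ) ^ j) ^ p)) / ρ)) := by
              have hρ0 : ρ ≠ 0 := by positivity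
              field_simp
        _ = cP d p * Kprod d L p (j + 1) x * ρ * P := by
              rw [hρeq, eK, ecK, e1]
              have hρ0 : ρ ≠ 0 := by positivity
              field_simp

end

end Summit.QuantumFields.BalabanUV.T4Continuum.NE3MajorantProfileTower
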